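import Mathlib
import HarnessLib
import Literature.MathematicalPhysics.StatisticalMechanics.FluctuationKernelComparisonProperty
import Literature.MathematicalPhysics.StatisticalMechanics.TuningParameterSegment

/-!
# The pair of step kernels `𝒞_{1+q,k+1}`, `𝒞_{1+q',k+1}` of ONE `TorusFRD` package, `q, q'` small
# symmetric: `StepKernelBounds` (also for the dilated kernel) and two-sided closeness of the
# multipliers ([ABKM19] Lemma 7.7 (7.75), Lemma 12.6 preparation)

For a package `𝒞_{A,k}` with clauses (o)–(v) of `GradientFRD.TorusFRD d` (for every elliptic
`A ∈ 𝓛(½,2)`), the weight tower of Theorem 7.1 built from the `q = 0` kernels `𝒞_{1,k}`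
(`AbkmWeightBounds`), and symmetric tuning parameters in the ball `Σ_{ij}|q_{ij}| ≤ T₀`
(`T₀ ≤ ½`, `K T₀ ≤ log(1+ρ)`, `ρ < θ̄`, `K = shellRatioConst`), this file supplies the kernel-level
hypotheses of `FluctuationKernelComparisonProperty.tayNormLE_fluct_sub_fluct_pow_abkm` /
`hamNorm_opB_sub_abkm_le` (the `ℓ = 1` integration property and `hb` of Lemma 12.6):

* `exists_isUnitSymm_eq_smul` — `q = T·B`, `B` unit symmetric, `T = Σ|q_{ij}|` (also for `q = 0`);
* **`stepKernelBounds_one_add_of_torusFRD`** — `StepKernelBounds` for `𝒞_{1+q,k+1}`, `q` in the ball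
  (`stepKernelBounds_of_torusFRD` ∘ `TuningParameterSegment`);
* **`stepKernelBounds_const_mul_one_add_of_torusFRD`** — `StepKernelBounds` for `p·𝒞_{1+q,k+1}` when
  `p ≥ 0`, `p(1+ρ) ≤ 1+ρ''`, `ρ'' < θ̄` (constant `A𝒫(ρ'')`);
* **`abs_re_fourierCoeff_one_add_sub_le_of_torusFRD`** —
  `|Re 𝒞̂_{1+q',k} − Re 𝒞̂_{1+q,k}| ≤ τ(1+τ) · Re 𝒞̂_{1+q',k}` for `Σ|q|,Σ|q'| ≤ ½`,
  `K·Σ|q'−q| ≤ log(1+τ)` (the segment between them is elliptic).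

Everything is proved; no named fact.

## References
* S. Adams, S. Buchholz, R. Kotecký, S. Müller, arXiv:1910.13564, Lemma 7.7, Lemma 8.4, Lemma 12.6
  [AdamsBuchholzKoteckyMuller2019].
* S. Buchholz, J. Funct. Anal. 275 (2018), Thm 2.4, Thm 4.5 [Buchholz2016].
-/

noncomputable section

namespace Literature.MathematicalPhysics.StatisticalMechanics.GradientRG

open scoped BigOperators
open Real Set Finset MeasureTheory
open Literature.MathematicalPhysics.StatisticalMechanics.GradientFRD
  (fourierCoeff cExt cExt_of_mem IsElliptic IsUnitSymm InShell iterDiff supNorm conv ellOp isElliptic_one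
    exists_inShell re_fourierCoeff_zero_of_sum_eq_zero)
open Literature.MathematicalPhysics.StatisticalMechanics.TorusPolymer (IsPolymer numBlocks)
open Literature.MathematicalPhysics.QuantumFieldTheory

variable {d M : ℕ} [NeZero M]

/-! ## `q = T · B` -/

omit [NeZero M] in
/-- Every symmetric `q` is `T·B` with `B` unit symmetric and `T = Σ|q_{ij}|`. [cite: Buchholz2016, Thm 2.4] -/
theorem exists_isUnitSymm_eq_smul {q : Matrix (Fin d) (Fin d) ℝ} (hq : q.IsSymm) :
    ∃ B : Matrix (Fin d) (Fin d) ℝ, IsUnitSymm B ∧ q = (∑ i, ∑ j, |q i j|) • B := by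
  by_cases h0 : ∑ i, ∑ j, |q i j| = 0
  · have hq0 : q = 0 := by
      ext i j
      have hle : |q i j| ≤ ∑ i, ∑ j, |q i j| :=
        (single_le_sum (f := fun j => |q i j|) (fun _ _ => abs_nonneg _) (mem_univ j)).trans
          (single_le_sum (f := fun i => ∑ j, |q i j|) (fun _ _ => sum_nonneg fun _ _ => abs_nonneg _)
            (mem_univ i))
      have : |q i j| = 0 := le_antisymm (h0 ▸ hle) (abs_nonneg _)
      simpa using this
    refine ⟨0, isUnitSymm_zero, ?_⟩
    rw [hq0, smul_zero]
  · have hpos : 0 < ∑ i, ∑ j, |q i j| :=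
      lt_of_le_of_ne (sum_nonneg fun _ _ => sum_nonneg fun _ _ => abs_nonneg _) (Ne.symm h0)
    exact ⟨(∑ i, ∑ j, |q i j|)⁻¹ • q, isUnitSymm_inv_smul hq hpos le_rfl, (smul_inv_smul_eq hpos.ne').symm⟩

/-! ## The package hypotheses (verbatim `TorusFRD d` clauses at `ω₀ = ½`, `Ω₀ = 2`) -/

section Package

variable {L N Mord R n ñ : ℕ} {θbar lam μ δ₁ δ₀ A𝒫 : ℝ}
    {𝒞 : Matrix (Fin d) (Fin d) ℝ → ℕ → (Fin d → ZMod M) → ℝ} {Mc : ℕ → ℝ}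
    {Cα : (Fin d → ℕ) → ℕ → ℝ} {c C : ℝ} {Cℓ : ℕ → ℝ}

/-- **`StepKernelBounds` for `𝒞_{1+q,k+1}`, `q` symmetric with `Σ|q_{ij}| ≤ T₀ ≤ ½`,
`K T₀ ≤ log(1+ρ)`, `ρ < θ̄`** (relative to the `q = 0` weights; `stepKernelBounds_of_torusFRD` with
`q = T·B`). [cite: AdamsBuchholzKoteckyMuller2019, Lemma 7.7] -/
theorem stepKernelBounds_one_add_of_torusFRD
    (hd : 3 ≤ d) (hMord : 1 ≤ Mord) (hMR : Mord ≤ R) (hLodd : Odd L) (hL : 2 ^ (d + 3) + 16 * R ≤ L)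
    (hθbar : 0 < θbar) (hlam : 0 < lam) (hn : 2 * Mord ≤ n) (hn2 : 2 ≤ n) (hnñ : n ≤ ñ)
    (hc : 0 < c) (hC1 : 0 ≤ Cℓ 1)
    (hallA : ∀ A : Matrix (Fin d) (Fin d) ℝ, IsElliptic (1 / 2 : ℝ) 2 A →
        (∀ k, 1 ≤ k → k ≤ N + 1 →
          ∑ x : Fin d → ZMod M, 𝒞 A k x = 0 ∧ ∀ x, 𝒞 A k (-x) = 𝒞 A k x) ∧
        (∀ k, 1 ≤ k → k ≤ N + 1 → ∀ φ : (Fin d → ZMod M) → ℝ, ∑ x, φ x = 0 →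
          0 ≤ ∑ x, ∑ y, φ x * 𝒞 A k (x - y) * φ y) ∧
        (∀ φ : (Fin d → ZMod M) → ℝ, ∑ x, φ x = 0 →
          ellOp A (conv (fun x => ∑ k ∈ Finset.Icc 1 (N + 1), 𝒞 A k x) φ) = φ) ∧
        (∀ k, 1 ≤ k → k ≤ N → Mc k ≤ 0 ∧
          ∀ x : Fin d → ZMod M, ((L : ℝ) ^ k) / 2 ≤ (supNorm x : ℝ) →
            𝒞 A k x = Mc k) ∧
        (∀ k, 1 ≤ k → k ≤ N + 1 → ∀ B : Matrix (Fin d) (Fin d) ℝ, IsUnitSymm B →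
          (∃ ε : ℝ, 0 < ε ∧ ∀ x : Fin d → ZMod M,
            ContDiffOn ℝ ⊤ (fun s : ℝ => 𝒞 (A + s • B) k x) (Set.Ioo (-ε) ε)) ∧
          ∀ α : Fin d → ℕ, ∑ i, α i ≤ n → ∀ ℓ : ℕ, ∀ x : Fin d → ZMod M,
            abs (iteratedDeriv ℓ (fun s : ℝ => iterDiff α (𝒞 (A + s • B) k) x) 0)
              ≤ Cα α ℓ / (L : ℝ) ^ ((k - 1) * (d - 2 + ∑ i, α i))) ∧
        (∀ k, 1 ≤ k → k ≤ N + 1 → ∀ j : ℕ, ∀ κ : Fin d → ZMod M, κ ≠ 0 → InShell L j κ →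
          (j < k →
            c / (L : ℝ) ^ (2 * (d + ñ) + 1) * (L : ℝ) ^ (2 * j)
                / (L : ℝ) ^ ((k - j) * (d - 1 + n)) ≤ (fourierCoeff (𝒞 A k) κ).re ∧
            ‖fourierCoeff (𝒞 A k) κ‖
              ≤ C * (L : ℝ) ^ (2 * (d + ñ) + 1) * (L : ℝ) ^ (2 * j)
                  / (L : ℝ) ^ ((k - j) * (d - 1 + n))) ∧
          (k ≤ j →
            c / (L : ℝ) ^ (2 * (d + ñ) + 1) * (L : ℝ) ^ (2 * k)
                ≤ (fourierCoeff (𝒞 A k) κ).re ∧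
            ‖fourierCoeff (𝒞 A k) κ‖ ≤ C * (L : ℝ) ^ (2 * k)) ∧
          ∀ B : Matrix (Fin d) (Fin d) ℝ, IsUnitSymm B → ∀ ℓ : ℕ, 1 ≤ ℓ →
            (j < k →
              ‖iteratedDeriv ℓ (fun s : ℝ => fourierCoeff (𝒞 (A + s • B) k) κ) 0‖
                ≤ Cℓ ℓ * (L : ℝ) ^ (2 * (d + ñ) + 1) * (L : ℝ) ^ (2 * j)
                    / (L : ℝ) ^ ((k - j) * (d - 1 + ñ))) ∧
            (k ≤ j →
              ‖iteratedDeriv ℓ (fun s : ℝ => fourierCoeff (𝒞 (A + s • B) k) κ) 0‖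
                ≤ Cℓ ℓ * (L : ℝ) ^ (2 * k))))
    (hB : AbkmWeightBounds L N Mord R n θbar lam μ δ₁ δ₀ A𝒫 (fun j => 𝒞 1 j)
      (abkmWeightData L N Mord R θbar (schedDelta δ₀ δ₁ N) fun j => 𝒞 1 j))
    {k : ℕ} (hk : k + 1 ≤ N + 1) {ρ : ℝ} (hρ0 : 0 ≤ ρ) (hρ : ρ < θbar)
    {T₀ : ℝ} (hT₀ : T₀ ≤ 1 / 2) (hKT₀ : shellRatioConst c (Cℓ 1) (L : ℝ) d ñ * T₀ ≤ Real.log (1 + ρ))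
    {q : Matrix (Fin d) (Fin d) ℝ} (hq : q.IsSymm) (hqT : ∑ i, ∑ j, |q i j| ≤ T₀) :
    StepKernelBounds (abkmWeightData L N Mord R θbar (schedDelta δ₀ δ₁ N) fun j => 𝒞 1 j) L k
      (weightIntConstRho θbar ρ (traceConst d Mord R lam (derivSum d n fun θ' _ => Cα θ' 0)))
      (secondDiffConst fun θ' => Cα θ' 0) (𝒞 ((1 : Matrix (Fin d) (Fin d) ℝ) + q) (k + 1)) := by
  obtain ⟨B, hBu, hqB⟩ := exists_isUnitSymm_eq_smul hq
  have hT0 : 0 ≤ ∑ i, ∑ j, |q i j| := sum_nonneg fun _ _ => sum_nonneg fun _ _ => abs_nonneg _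
  have hL0 : (0 : ℝ) ≤ (L : ℝ) := Nat.cast_nonneg _
  have hK0 : 0 ≤ shellRatioConst c (Cℓ 1) (L : ℝ) d ñ := shellRatioConst_nonneg hc hC1 hL0 d ñ
  have hKT : shellRatioConst c (Cℓ 1) (L : ℝ) d ñ * ∑ i, ∑ j, |q i j| ≤ Real.log (1 + ρ) :=
    (mul_le_mul_of_nonneg_left hqT hK0).trans hKT₀
  have h := stepKernelBounds_of_torusFRD hd hMord hMR hLodd hL hθbar hlam hn hn2 hnñ hc hC1 hallA hB hk hρ0 hρ
    hBu hT0 (hqT.trans hT₀) hKT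
  rwa [← hqB] at h

/-- **`StepKernelBounds` for the dilated kernel `p·𝒞_{1+q,k+1}`** when `p ≥ 0`, `p(1+ρ) ≤ 1+ρ''`,
`ρ'' < θ̄` (multiplier domination `p·Re𝒞̂_{1+q} ≤ p(1+ρ)ĉ_{k+1} ≤ (1+ρ'')ĉ_{k+1}`).
[cite: AdamsBuchholzKoteckyMuller2019, Lemma 7.7] -/
theorem stepKernelBounds_const_mul_one_add_of_torusFRD
    (hd : 3 ≤ d) (hMord : 1 ≤ Mord) (hMR : Mord ≤ R) (hLodd : Odd L) (hL : 2 ^ (d + 3) + 16 * R ≤ L)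
    (hθbar : 0 < θbar) (hlam : 0 < lam) (hn : 2 * Mord ≤ n) (hn2 : 2 ≤ n) (hnñ : n ≤ ñ)
    (hc : 0 < c) (hC1 : 0 ≤ Cℓ 1)
    (hallA : ∀ A : Matrix (Fin d) (Fin d) ℝ, IsElliptic (1 / 2 : ℝ) 2 A →
        (∀ k, 1 ≤ k → k ≤ N + 1 →
          ∑ x : Fin d → ZMod M, 𝒞 A k x = 0 ∧ ∀ x, 𝒞 A k (-x) = 𝒞 A k x) ∧
        (∀ k, 1 ≤ k → k ≤ N + 1 → ∀ φ : (Fin d → ZMod M) → ℝ, ∑ x, φ x = 0 →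
          0 ≤ ∑ x, ∑ y, φ x * 𝒞 A k (x - y) * φ y) ∧
        (∀ φ : (Fin d → ZMod M) → ℝ, ∑ x, φ x = 0 →
          ellOp A (conv (fun x => ∑ k ∈ Finset.Icc 1 (N + 1), 𝒞 A k x) φ) = φ) ∧
        (∀ k, 1 ≤ k → k ≤ N → Mc k ≤ 0 ∧
          ∀ x : Fin d → ZMod M, ((L : ℝ) ^ k) / 2 ≤ (supNorm x : ℝ) →
            𝒞 A k x = Mc k) ∧
        (∀ k, 1 ≤ k → k ≤ N + 1 → ∀ B : Matrix (Fin d) (Fin d) ℝ, IsUnitSymm B →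
          (∃ ε : ℝ, 0 < ε ∧ ∀ x : Fin d → ZMod M,
            ContDiffOn ℝ ⊤ (fun s : ℝ => 𝒞 (A + s • B) k x) (Set.Ioo (-ε) ε)) ∧
          ∀ α : Fin d → ℕ, ∑ i, α i ≤ n → ∀ ℓ : ℕ, ∀ x : Fin d → ZMod M,
            abs (iteratedDeriv ℓ (fun s : ℝ => iterDiff α (𝒞 (A + s • B) k) x) 0)
              ≤ Cα α ℓ / (L : ℝ) ^ ((k - 1) * (d - 2 + ∑ i, α i))) ∧
        (∀ k, 1 ≤ k → k ≤ N + 1 → ∀ j : ℕ, ∀ κ : Fin d → ZMod M, κ ≠ 0 → InShell L j κ →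
          (j < k →
            c / (L : ℝ) ^ (2 * (d + ñ) + 1) * (L : ℝ) ^ (2 * j)
                / (L : ℝ) ^ ((k - j) * (d - 1 + n)) ≤ (fourierCoeff (𝒞 A k) κ).re ∧
            ‖fourierCoeff (𝒞 A k) κ‖
              ≤ C * (L : ℝ) ^ (2 * (d + ñ) + 1) * (L : ℝ) ^ (2 * j)
                  / (L : ℝ) ^ ((k - j) * (d - 1 + n))) ∧
          (k ≤ j →
            c / (L : ℝ) ^ (2 * (d + ñ) + 1) * (L : ℝ) ^ (2 * k)
                ≤ (fourierCoeff (𝒞 A k) κ).re ∧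
            ‖fourierCoeff (𝒞 A k) κ‖ ≤ C * (L : ℝ) ^ (2 * k)) ∧
          ∀ B : Matrix (Fin d) (Fin d) ℝ, IsUnitSymm B → ∀ ℓ : ℕ, 1 ≤ ℓ →
            (j < k →
              ‖iteratedDeriv ℓ (fun s : ℝ => fourierCoeff (𝒞 (A + s • B) k) κ) 0‖
                ≤ Cℓ ℓ * (L : ℝ) ^ (2 * (d + ñ) + 1) * (L : ℝ) ^ (2 * j)
                    / (L : ℝ) ^ ((k - j) * (d - 1 + ñ))) ∧
            (k ≤ j →
              ‖iteratedDeriv ℓ (fun s : ℝ => fourierCoeff (𝒞 (A + s • B) k) κ) 0‖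
                ≤ Cℓ ℓ * (L : ℝ) ^ (2 * k))))
    (hB : AbkmWeightBounds L N Mord R n θbar lam μ δ₁ δ₀ A𝒫 (fun j => 𝒞 1 j)
      (abkmWeightData L N Mord R θbar (schedDelta δ₀ δ₁ N) fun j => 𝒞 1 j))
    {k : ℕ} (hk : k + 1 ≤ N + 1) {ρ : ℝ} (hρ0 : 0 ≤ ρ)
    {T₀ : ℝ} (hT₀ : T₀ ≤ 1 / 2) (hKT₀ : shellRatioConst c (Cℓ 1) (L : ℝ) d ñ * T₀ ≤ Real.log (1 + ρ))
    {q : Matrix (Fin d) (Fin d) ℝ} (hq : q.IsSymm) (hqT : ∑ i, ∑ j, |q i j| ≤ T₀)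
    {p ρ'' : ℝ} (hp : 0 ≤ p) (hρ''0 : 0 ≤ ρ'') (hρ'' : ρ'' < θbar) (hpρ : p * (1 + ρ) ≤ 1 + ρ'') :
    StepKernelBounds (abkmWeightData L N Mord R θbar (schedDelta δ₀ δ₁ N) fun j => 𝒞 1 j) L k
      (weightIntConstRho θbar ρ'' (traceConst d Mord R lam (derivSum d n fun θ' _ => Cα θ' 0)))
      (p * secondDiffConst fun θ' => Cα θ' 0)
      (fun x => p * 𝒞 ((1 : Matrix (Fin d) (Fin d) ℝ) + q) (k + 1) x) := by
  have h8 : 8 ≤ 2 ^ (d + 3) := by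
    calc 8 = 2 ^ 3 := by norm_num
      _ ≤ 2 ^ (d + 3) := Nat.pow_le_pow_right (by norm_num) (by omega)
  have hL2 : 2 ≤ L := by omega
  have hL1 : 1 ≤ L := by omega
  have hd2 : 2 ≤ d := by omega
  obtain ⟨B, hBu, hqB⟩ := exists_isUnitSymm_eq_smul hq
  set T := ∑ i, ∑ j, |q i j| with hTdef
  have hT0 : 0 ≤ T := sum_nonneg fun _ _ => sum_nonneg fun _ _ => abs_nonneg _
  have hT : T ≤ 1 / 2 := hqT.trans hT₀
  have hL0 : (0 : ℝ) ≤ (L : ℝ) := Nat.cast_nonneg _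
  have hK0 : 0 ≤ shellRatioConst c (Cℓ 1) (L : ℝ) d ñ := shellRatioConst_nonneg hc hC1 hL0 d ñ
  have hKT : shellRatioConst c (Cℓ 1) (L : ℝ) d ñ * T ≤ Real.log (1 + ρ) :=
    (mul_le_mul_of_nonneg_left hqT hK0).trans hKT₀
  set A' : Matrix (Fin d) (Fin d) ℝ := 1 + q with hA'
  have hA'TB : A' = 1 + T • B := by rw [hA', hqB]
  have hellA' : IsElliptic (1 / 2 : ℝ) 2 A' := by rw [hA'TB]; exact isElliptic_one_add_smul hBu hT0 hT
  have hqA := hallA A' hellA'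
  -- regularity of every elliptic family with the same constants (clause (iv), `ℓ = 0`)
  have hreg : ∀ A : Matrix (Fin d) (Fin d) ℝ, IsElliptic (1 / 2 : ℝ) 2 A →
      ∀ j, 1 ≤ j → j ≤ N + 1 → ∀ θ' : Fin d → ℕ, ∑ i, θ' i ≤ n → ∀ x,
        |iterDiff θ' (𝒞 A j) x| ≤ Cα θ' 0 / (L : ℝ) ^ ((j - 1) * (d - 2 + ∑ i, θ' i)) := by
    intro A hA j hj1 hjN θ' hθ' x
    obtain ⟨-, hb⟩ := (hallA A hA).2.2.2.2.1 j hj1 hjN 0 isUnitSymm_zero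
    have := hb θ' hθ' 0 x
    rw [iteratedDeriv_zero] at this
    simpa only [smul_zero, add_zero] using this
  have hqeven : ∀ x, 𝒞 A' (k + 1) (-x) = 𝒞 A' (k + 1) x := (hqA.1 (k + 1) (by omega) hk).2
  have hq_nonneg : ∀ κ, 0 ≤ (fourierCoeff (𝒞 A' (k + 1)) κ).re := fun κ =>
    re_fourierCoeff_nonneg_of_torusFRD hqA.1 hqA.2.2.2.2.2 hc hL2 (by omega) hk κ
  have hq_le : ∀ κ, p * (fourierCoeff (𝒞 A' (k + 1)) κ).re ≤
      (1 + ρ'') * cExt N (fun j => fourierCoeff (𝒞 1 j) κ) (k + 1) := by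
    intro κ
    have hnn : 0 ≤ cExt N (fun j => fourierCoeff (𝒞 1 j) κ) (k + 1) := hB.multipliers_nonneg (k + 1) κ
    have h1 : (fourierCoeff (𝒞 A' (k + 1)) κ).re ≤ (1 + ρ) * cExt N (fun j => fourierCoeff (𝒞 1 j) κ) (k + 1) := by
      rw [cExt_of_mem (f := fun j => fourierCoeff (𝒞 1 j) κ) (by omega) hk, hA'TB]
      exact re_fourierCoeff_one_add_smul_le (fun A hA => (hallA A hA).1) (fun A hA => (hallA A hA).2.2.2.2.1)
        (fun A hA => (hallA A hA).2.2.2.2.2) hc hC1 hL2 hnñ hBu hT0 hT (by omega) hk hρ0 hKT κ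
    calc p * (fourierCoeff (𝒞 A' (k + 1)) κ).re ≤ p * ((1 + ρ) * cExt N (fun j => fourierCoeff (𝒞 1 j) κ) (k + 1)) :=
          mul_le_mul_of_nonneg_left h1 hp
      _ = p * (1 + ρ) * cExt N (fun j => fourierCoeff (𝒞 1 j) κ) (k + 1) := by ring
      _ ≤ (1 + ρ'') * cExt N (fun j => fourierCoeff (𝒞 1 j) κ) (k + 1) :=
          mul_le_mul_of_nonneg_right hpρ hnn
  have hγ : ∀ qi : quadIndex d,
      ((L ^ (d * k) : ℕ) : ℝ) * |gradCov (𝒞 A' (k + 1)) qi| ≤ secondDiffConst fun θ' => Cα θ' 0 :=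
    fun qi => abs_gradCov_abkm_le (𝒞 := fun j => 𝒞 A' j) hd2 hn2 hL1 (hreg A' hellA') hk qi
  exact AbkmWeightBounds.stepKernelBounds_const_mul hd2 hMord hMR hLodd hL hθbar hlam hB hn (hreg 1 isElliptic_one)
    hk hρ''0 hρ'' hqeven hq_nonneg hp hq_le hγ

/-- **`|Re 𝒞̂_{1+q',k}(κ) − Re 𝒞̂_{1+q,k}(κ)| ≤ τ(1+τ) · Re 𝒞̂_{1+q',k}(κ)`** for symmetric `q, q'` with
`Σ|q|, Σ|q'| ≤ ½` and `K · Σ|q' − q| ≤ log(1+τ)`, `τ ≥ 0` (the segment between them is elliptic).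
[cite: AdamsBuchholzKoteckyMuller2019, Lemma 7.7 (7.75)] -/
theorem abs_re_fourierCoeff_one_add_sub_le_of_torusFRD
    (ho : ∀ A : Matrix (Fin d) (Fin d) ℝ, IsElliptic (1 / 2 : ℝ) 2 A →
      ∀ k, 1 ≤ k → k ≤ N + 1 → ∑ x : Fin d → ZMod M, 𝒞 A k x = 0 ∧ ∀ x, 𝒞 A k (-x) = 𝒞 A k x)
    (hiv : ∀ A : Matrix (Fin d) (Fin d) ℝ, IsElliptic (1 / 2 : ℝ) 2 A →
      ∀ k, 1 ≤ k → k ≤ N + 1 → ∀ B : Matrix (Fin d) (Fin d) ℝ, IsUnitSymm B →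
        (∃ ε : ℝ, 0 < ε ∧ ∀ x : Fin d → ZMod M,
          ContDiffOn ℝ ⊤ (fun s : ℝ => 𝒞 (A + s • B) k x) (Set.Ioo (-ε) ε)) ∧
        ∀ α : Fin d → ℕ, ∑ i, α i ≤ n → ∀ ℓ : ℕ, ∀ x : Fin d → ZMod M,
          abs (iteratedDeriv ℓ (fun s : ℝ => GradientFRD.iterDiff α (𝒞 (A + s • B) k) x) 0)
            ≤ Cα α ℓ / (L : ℝ) ^ ((k - 1) * (d - 2 + ∑ i, α i)))
    (hv : ∀ A : Matrix (Fin d) (Fin d) ℝ, IsElliptic (1 / 2 : ℝ) 2 A →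
      ∀ k, 1 ≤ k → k ≤ N + 1 → ∀ j : ℕ, ∀ κ : Fin d → ZMod M, κ ≠ 0 → InShell L j κ →
        (j < k →
          c / (L : ℝ) ^ (2 * (d + ñ) + 1) * (L : ℝ) ^ (2 * j)
              / (L : ℝ) ^ ((k - j) * (d - 1 + n)) ≤ (fourierCoeff (𝒞 A k) κ).re ∧
          ‖fourierCoeff (𝒞 A k) κ‖
            ≤ C * (L : ℝ) ^ (2 * (d + ñ) + 1) * (L : ℝ) ^ (2 * j)
                / (L : ℝ) ^ ((k - j) * (d - 1 + n))) ∧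
        (k ≤ j →
          c / (L : ℝ) ^ (2 * (d + ñ) + 1) * (L : ℝ) ^ (2 * k)
              ≤ (fourierCoeff (𝒞 A k) κ).re ∧
          ‖fourierCoeff (𝒞 A k) κ‖ ≤ C * (L : ℝ) ^ (2 * k)) ∧
        ∀ B : Matrix (Fin d) (Fin d) ℝ, IsUnitSymm B → ∀ ℓ : ℕ, 1 ≤ ℓ →
          (j < k →
            ‖iteratedDeriv ℓ (fun s : ℝ => fourierCoeff (𝒞 (A + s • B) k) κ) 0‖
              ≤ Cℓ ℓ * (L : ℝ) ^ (2 * (d + ñ) + 1) * (L : ℝ) ^ (2 * j)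
                  / (L : ℝ) ^ ((k - j) * (d - 1 + ñ))) ∧
          (k ≤ j →
            ‖iteratedDeriv ℓ (fun s : ℝ => fourierCoeff (𝒞 (A + s • B) k) κ) 0‖
              ≤ Cℓ ℓ * (L : ℝ) ^ (2 * k)))
    (hc : 0 < c) (hC1 : 0 ≤ Cℓ 1) (hL : 2 ≤ L) (hnñ : n ≤ ñ)
    {q q' : Matrix (Fin d) (Fin d) ℝ} (hq : q.IsSymm) (hq' : q'.IsSymm)
    (hq2 : ∑ i, ∑ j, |q i j| ≤ 1 / 2) (hq'2 : ∑ i, ∑ j, |q' i j| ≤ 1 / 2)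
    {k : ℕ} (hk1 : 1 ≤ k) (hkN : k ≤ N + 1) {τ : ℝ} (hτ : 0 ≤ τ)
    (hKT : shellRatioConst c (Cℓ 1) (L : ℝ) d ñ * ∑ i, ∑ j, |(q' - q) i j| ≤ Real.log (1 + τ))
    (κ : Fin d → ZMod M) :
    |(fourierCoeff (𝒞 ((1 : Matrix (Fin d) (Fin d) ℝ) + q') k) κ).re -
        (fourierCoeff (𝒞 ((1 : Matrix (Fin d) (Fin d) ℝ) + q) k) κ).re| ≤
      τ * (1 + τ) * (fourierCoeff (𝒞 ((1 : Matrix (Fin d) (Fin d) ℝ) + q') k) κ).re := by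
  set T := ∑ i, ∑ j, |(q' - q) i j| with hTdef
  have hT0 : 0 ≤ T := sum_nonneg fun _ _ => sum_nonneg fun _ _ => abs_nonneg _
  rcases hT0.eq_or_lt with hT | hT
  · -- `q' = q`
    have hqq : q' = q := by
      have hz : q' - q = 0 := by
        ext i j
        have hle : |(q' - q) i j| ≤ T :=
          (single_le_sum (f := fun j => |(q' - q) i j|) (fun _ _ => abs_nonneg _) (mem_univ j)).trans
            (single_le_sum (f := fun i => ∑ j, |(q' - q) i j|)
              (fun _ _ => sum_nonneg fun _ _ => abs_nonneg _) (mem_univ i))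
        have : |(q' - q) i j| = 0 := le_antisymm (hT ▸ hle) (abs_nonneg _)
        simpa using this
      exact sub_eq_zero.1 hz
    rw [hqq, sub_self, abs_zero]
    have hell : IsElliptic (1 / 2 : ℝ) 2 ((1 : Matrix (Fin d) (Fin d) ℝ) + q) :=
      isElliptic_one_add_of_entrySum_le hq hq2
    by_cases hκ : κ = 0
    · rw [hκ, re_fourierCoeff_zero_of_sum_eq_zero ((ho _ hell) k hk1 hkN).1, mul_zero]
    · exact mul_nonneg (mul_nonneg hτ (by linarith))
        (re_fourierCoeff_pos_of_torusFRD (hv _ hell) hc hL hk1 hkN hκ).le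
  · -- a genuine segment
    set B : Matrix (Fin d) (Fin d) ℝ := T⁻¹ • (q' - q) with hBdef
    have hBu : IsUnitSymm B := isUnitSymm_direction hq hq' hT le_rfl
    have hell : ∀ t ∈ Icc (0 : ℝ) T,
        IsElliptic (1 / 2 : ℝ) 2 ((1 : Matrix (Fin d) (Fin d) ℝ) + q + t • B) :=
      isElliptic_segment_of_entrySum_le hq hq' hq2 hq'2 hT
    have hend : (1 : Matrix (Fin d) (Fin d) ℝ) + q + T • B = 1 + q' := segment_end hT.ne'
    have h := abs_re_fourierCoeff_sub_le_of_torusFRD ho hiv hv hc hC1 hL hnñ hBu hT0 hell hk1 hkN hτ hKT κ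
    rwa [hend] at h


end Package

end Literature.MathematicalPhysics.StatisticalMechanics.GradientRG

end
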